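import Summits.BirchSwinnertonDyer.BirchSwinnertonDyer.Theorems.ResidualThetaTransportAtTwoSignedMuSeedAtTwoPlusLayerDual
import Summits.BirchSwinnertonDyer.BirchSwinnertonDyer.Theorems.ResidualThetaTransportAtTwoSignedMuVanishingAtTwoPlusLineV42
import HarnessLib

/-!
# Seed crux `SignedMuSeedAtTwoPlus` (stmt-BirchSwinnertonDyer-21438) and its parent Kμ⁺ `SignedMuVanishingAtTwoPlus`
# (stmt-BirchSwinnertonDyer-20689): the seed, conjunct 1 and the crux BY NAME from finite-layer certificates in
# Selmer currency; stub 2 `FinitenessTransport` of line `fukuda-step` VERBATIM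

Cell `bsd-wall`, width seat `bsd-wall-rtt-p4-w3` (g3). THEOREMS ONLY (no `def`, no named fact, no `sorry`); every
certificate is a HYPOTHESIS; BSD is not proved by this. Sequel of `…SignedMuSeedAtTwoPlusLayerDual`
(`isTorsion_and_mu_eq_zero_of_card_fixed_lt`: for a datum `D` of `Sel^ε(E/K_∞)` at a topological generator `γ`,
`#Sel^ε_∞[p,(γ−1)^b] < p^{b−a}·#Sel^ε_∞[p,(γ−1)^a]` for some `a ≤ b` ⟹ `X^ε` torsion, `μ^ε = 0`).

* §1 `pow_two_pow_sub_one_apply` — Frobenius on the `2`-torsion: for an additive endomorphism `c` and `2s = 0`,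
  `(c − 1)^{2^k} s = c^{2^k} s − s`; hence `c^{2^k} s = s ⟺ (c−1)^{2^k} s = 0` (`pow_two_pow_apply_eq_self_iff`), the
  bridge between line `fukuda-step`'s «fixed by `γ^{2^n}`» and the `(2, T^{2^n})`-layers.
* §2 **`finitenessTransport`** = stub 2 `FinitenessTransport` of `Cruxes/SignedMuSeedAtTwoPlus/Lines/fukuda_step.lean`
  VERBATIM (`RankZeroOfSlackStep`, `StepAt`, `fixedTwoTorsion` unfolded): a certified slack step
  `#Sel⁺_∞[2]^{γ^{2^{n+1}}} < 2^{2^n}·#Sel⁺_∞[2]^{γ^{2^n}}` makes `Sel⁺(A/ℚ_∞)[2]` finite (the hypothesis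
  `RankZeroOfSlackStep` is not even needed — it is the tree's tower-gap lemma; `X⁺` is finitely generated by
  `SignedSelmerDualData.moduleFinite`). With this seat's `LayerRank.rankZeroOfSlackStep`, TWO of the three stubs of
  line `fukuda-step` close by `exact`; the third (`FukudaCertificate`, the per-class computation) is the content.
* §3 `signedMuSeedAtTwoPlus_of_fixedCertificate` — **the seed child 21438 BY NAME** from: every habitat⁺ `W` has a
  congruent good-supersingular `a₂ = 0` curve `A` (`A := W` allowed) such that at every cyclotomic `(κ, γ)` some pair
  of layers `a ≤ b` satisfies the Selmer-currency inequality; `muAlgebraic_of_fixedCertificate` — conjunct 1 of Kμ⁺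
  verbatim; `signedMuVanishingAtTwoPlus_of_fixedCertificate_of_analytic` — THE CRUX BY NAME with the analytic child
  21437 (lead g3's `signedMuVanishingAtTwoPlus_of_analytic_of_seed`).

References: [Fukuda1994] T. Fukuda, Proc. Japan Acad. 70 (1994) Thm. 1; [Kobayashi2003] S. Kobayashi, Invent. Math. 152
(2003) Thm. 1.2; [GreenbergLNM1716] §1 pp. 60, 65; [GreenbergVatsal2000] Prop. (2.8).
-/

set_option autoImplicit false
set_option linter.dupNamespace false

noncomputable section

open scoped Classical

open WeierstrassCurve Literature.NumberTheory.EllipticCurves Literature.NumberTheory.EllipticCurves.IwasawaAlgebra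
  Literature.NumberTheory.EllipticCurves.Kobayashi2003 Literature.NumberTheory.EllipticCurves.Rank1Residual
  Summit.BirchSwinnertonDyer.BirchSwinnertonDyer.Theses.ResidualThetaTransportAtTwo

namespace Summit.BirchSwinnertonDyer.BirchSwinnertonDyer.Theorems.SignedMuAtTwo.LayerDual

/-! ## §1. Frobenius on the `2`-torsion: `(c − 1)^{2^k} s = c^{2^k} s − s` -/

/-- **`(c − 1)^{2^k} s = c^{2^k} s − s` when `2s = 0`** (`c` an additive endomorphism; induction on `k`, the cross
terms are `2(⋯) = 0`). [folklore] -/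
theorem pow_two_pow_sub_one_apply {S : Type*} [AddCommGroup S] (c : AddMonoid.End S) (k : ℕ) (s : S)
    (hs : 2 • s = 0) : ((c - 1) ^ (2 ^ k : ℕ)) s = (c ^ (2 ^ k : ℕ)) s - s := by
  induction k generalizing s with
  | zero =>
    rw [pow_zero, pow_one, pow_one, IwasawaDual.End_sub_apply, AddMonoid.End.one_apply]
  | succ k ih =>
    have hneg : ∀ t : S, 2 • t = 0 → -t = t := fun t ht ↦ by
      rw [neg_eq_iff_add_eq_zero, ← two_nsmul, ht]
    have hcs : 2 • ((c ^ (2 ^ k : ℕ)) s) = 0 := by rw [← map_nsmul, hs, map_zero]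
    rw [pow_succ, pow_mul, pow_mul, sq, sq, AddMonoid.End.coe_mul, Function.comp_apply, AddMonoid.End.coe_mul,
      Function.comp_apply, ih s hs, map_sub, ih _ hcs, ih s hs]
    calc (c ^ (2 ^ k : ℕ)) ((c ^ (2 ^ k : ℕ)) s) - (c ^ (2 ^ k : ℕ)) s - ((c ^ (2 ^ k : ℕ)) s - s)
        = (c ^ (2 ^ k : ℕ)) ((c ^ (2 ^ k : ℕ)) s) - ((c ^ (2 ^ k : ℕ)) s + (c ^ (2 ^ k : ℕ)) s) + s := by abel
      _ = (c ^ (2 ^ k : ℕ)) ((c ^ (2 ^ k : ℕ)) s) - s := by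
          rw [← two_nsmul, hcs, sub_zero, sub_eq_add_neg _ s, hneg s hs]

/-- For `2s = 0`: `c^{2^k} s = s ⟺ (c − 1)^{2^k} s = 0`. [folklore] -/
theorem pow_two_pow_apply_eq_self_iff {S : Type*} [AddCommGroup S] (c : AddMonoid.End S) (k : ℕ) (s : S)
    (hs : 2 • s = 0) : (c ^ (2 ^ k : ℕ)) s = s ↔ ((c - 1) ^ (2 ^ k : ℕ)) s = 0 := by
  rw [pow_two_pow_sub_one_apply c k s hs, sub_eq_zero]

/-! ## §2. Stub 2 `FinitenessTransport` of line `fukuda-step`, verbatim -/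

section Fukuda

/-- **Stub 2 `stub_finitenessTransport` of line `fukuda-step` (seed crux `SignedMuSeedAtTwoPlus`,
stmt-BirchSwinnertonDyer-21438) — its statement `FinitenessTransport` VERBATIM** (`RankZeroOfSlackStep`, `StepAt`,
`fixedTwoTorsion` unfolded): at a cyclotomic `(κ, γ)`, a certified slack step
`#Sel⁺_∞[2]^{γ^{2^{n+1}}} < 2^{2^n} · #Sel⁺_∞[2]^{γ^{2^n}}` makes `Sel⁺(A/ℚ_∞)[2]` finite. Proof: on the `2`-torsion
`γ^{2^k} s = s ⟺ (γ−1)^{2^k} s = 0` (§1), so the step is the Selmer-currency certificate of `…LayerDual` with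
`a = 2^n`, `b = 2^{n+1}`; then `X⁺` torsion with `μ = 0` ⟺ `Sel⁺_∞[2]` finite (`isTorsion_and_mu_eq_zero_iff_finite_selmer_pTorsion`).
The algebraic hypothesis (stub 1) is not used — it is the tree's tower-gap lemma. [cite: Fukuda1994, Thm. 1]
[cite: Kobayashi2003, Thm. 1.2] [cite: GreenbergLNM1716, §1 p. 60] -/
theorem finitenessTransport :
    (∀ (X : Type) [AddCommGroup X] [Module (IwasawaAlgebra 2) X] [Module.Finite (IwasawaAlgebra 2) X] (m : ℕ),
      0 < m →
      Nat.card (X ⧸ (Ideal.span {PowerSeries.C (2 : ℤ_[2]), (PowerSeries.X : IwasawaAlgebra 2) ^ (2 * m)} •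
          (⊤ : Submodule (IwasawaAlgebra 2) X))) <
        2 ^ m * Nat.card (X ⧸ (Ideal.span {PowerSeries.C (2 : ℤ_[2]), (PowerSeries.X : IwasawaAlgebra 2) ^ m} •
          (⊤ : Submodule (IwasawaAlgebra 2) X))) →
      Finite (X ⧸ (IwasawaAlgebra.augIdealP 2 • (⊤ : Submodule (IwasawaAlgebra 2) X)))) →
    ∀ (A : WeierstrassCurve ℚ) [A.IsElliptic] (κ : ZpExtension ℚ 2) (γ : Field.absoluteGaloisGroup ℚ),
      κ.IsCyclotomic → κ.IsTopGenerator γ →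
      (∃ D : SignedSelmerDualData A κ γ 1, Module.Finite (IwasawaAlgebra 2) D.X) →
      (∃ n : ℕ,
        ({s : signedSelmerInfty A κ 1 | 2 • s = 0 ∧ ((conjSignedSelmerInfty A κ 1 γ) ^ (2 ^ (n + 1))) s = s}.Finite ∧
          Nat.card {s : signedSelmerInfty A κ 1 | 2 • s = 0 ∧ ((conjSignedSelmerInfty A κ 1 γ) ^ (2 ^ (n + 1))) s = s} <
            2 ^ (2 ^ n) *
              Nat.card {s : signedSelmerInfty A κ 1 | 2 • s = 0 ∧ ((conjSignedSelmerInfty A κ 1 γ) ^ (2 ^ n)) s = s})) →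
      {s : signedSelmerInfty A κ 1 | 2 • s = 0}.Finite := by
  intro _ A _ κ γ _ hγ hD hstep
  obtain ⟨D, _⟩ := hD
  obtain ⟨n, -, hlt⟩ := hstep
  have hconv : ∀ m : ℕ,
      Nat.card {s : signedSelmerInfty A κ 1 | 2 • s = 0 ∧ ((conjSignedSelmerInfty A κ 1 γ) ^ (2 ^ m : ℕ)) s = s} =
        Nat.card {s : signedSelmerInfty A κ 1 //
          2 • s = 0 ∧ ((conjSignedSelmerInfty A κ 1 γ - 1) ^ (2 ^ m : ℕ)) s = 0} := by
    intro m
    refine Nat.card_congr (Equiv.subtypeEquivRight fun s ↦ ?_)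
    change (2 • s = 0 ∧ ((conjSignedSelmerInfty A κ 1 γ) ^ (2 ^ m : ℕ)) s = s) ↔ _
    constructor
    · rintro ⟨h2, hc⟩
      exact ⟨h2, (pow_two_pow_apply_eq_self_iff _ m s h2).mp hc⟩
    · rintro ⟨h2, hc⟩
      exact ⟨h2, (pow_two_pow_apply_eq_self_iff _ m s h2).mpr hc⟩
  rw [hconv (n + 1), hconv n] at hlt
  have hab : 2 ^ n ≤ 2 ^ (n + 1) := Nat.pow_le_pow_right (by norm_num) (by omega)
  have hba : 2 ^ (n + 1) - 2 ^ n = 2 ^ n := by rw [pow_succ]; omega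
  rw [show (2 : ℕ) ^ (2 ^ n) = 2 ^ (2 ^ (n + 1) - 2 ^ n) by rw [hba]] at hlt
  haveI : Module.Finite (IwasawaAlgebra 2) D.X := SignedSelmerDualData.moduleFinite hγ D
  exact (isTorsion_and_mu_eq_zero_iff_finite_selmer_pTorsion D).mp
    (isTorsion_and_mu_eq_zero_of_card_fixed_lt D hγ hab hlt)

end Fukuda

/-! ## §3. The seed child, conjunct 1 of Kμ⁺ and the crux BY NAME from Selmer-currency certificates -/

section Seed

/-- **The seed child 21438 `SignedMuSeedAtTwoPlus` BY NAME from finite-layer certificates in Selmer currency**: every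
habitat⁺ curve `W` is congruent mod `2` to a good-supersingular `a₂ = 0` curve `A` (`A := W` allowed) such that at
every cyclotomic `(κ, γ)` SOME pair of layers `a ≤ b` has
`#Sel⁺(A/ℚ_∞)[2, (γ−1)^b] < 2^{b−a} · #Sel⁺(A/ℚ_∞)[2, (γ−1)^a]`. (Then `X⁺_A` is torsion with `μ = 0` for EVERY datum,
`isTorsion_and_mu_eq_zero_of_card_fixed_lt`.) The certificate is a hypothesis; per class it is a finite computation
ONCE the two counts are identified with finite-layer Selmer groups (control). [cite: Fukuda1994, Thm. 1]
[cite: Kobayashi2003, Thm. 1.2] [cite: GreenbergVatsal2000, Prop. (2.8)] -/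
theorem signedMuSeedAtTwoPlus_of_fixedCertificate
    (hcert : ∀ (W : WeierstrassCurve ℚ) [W.IsElliptic] [W.IsGloballyMinimal], ¬ W.HasCM → W.analyticRank = 0 →
      GoodSS W 2 → W.frobeniusTrace 2 = 0 → W.Δ < 0 →
      ∃ (A : WeierstrassCurve ℚ) (_ : A.IsElliptic) (_ : A.IsGloballyMinimal), GoodSS A 2 ∧ A.frobeniusTrace 2 = 0 ∧
        (∃ e : WeierstrassCurve.geomTorsion W (2 : ℤ) ≃+ WeierstrassCurve.geomTorsion A (2 : ℤ),
          ∀ (σ : Field.absoluteGaloisGroup ℚ) (P : WeierstrassCurve.geomTorsion W (2 : ℤ)), e (σ • P) = σ • e P) ∧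
        ∀ (κ : ZpExtension ℚ 2) (γ : Field.absoluteGaloisGroup ℚ), κ.IsCyclotomic → κ.IsTopGenerator γ →
          ∃ a b : ℕ, a ≤ b ∧
            Nat.card {s : signedSelmerInfty A κ 1 // 2 • s = 0 ∧ ((conjSignedSelmerInfty A κ 1 γ - 1) ^ b) s = 0} <
              2 ^ (b - a) *
                Nat.card {s : signedSelmerInfty A κ 1 // 2 • s = 0 ∧ ((conjSignedSelmerInfty A κ 1 γ - 1) ^ a) s = 0}) :
    SignedMuSeedAtTwoPlus := by
  intro W _ _ hCM hr hss ha hΔ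
  obtain ⟨A, hAe, hAm, hssA, haA, hiso, hc⟩ := hcert W hCM hr hss ha hΔ
  refine ⟨A, hAe, hAm, hssA, haA, hiso, fun κ γ hκ hγ D _ ↦ ?_⟩
  obtain ⟨a, b, hab, hlt⟩ := hc κ γ hκ hγ
  exact isTorsion_and_mu_eq_zero_of_card_fixed_lt D hγ hab hlt

/-- **Conjunct 1 of Kμ⁺ VERBATIM from the Selmer-currency certificates** (the seed above through the proved
propagation, lead g3's `muAlgebraic_iff_signedMuSeedAtTwoPlus`). [cite: GreenbergVatsal2000, Prop. (2.8)] [cite: Fukuda1994, Thm. 1] -/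
theorem muAlgebraic_of_fixedCertificate
    (hcert : ∀ (W : WeierstrassCurve ℚ) [W.IsElliptic] [W.IsGloballyMinimal], ¬ W.HasCM → W.analyticRank = 0 →
      GoodSS W 2 → W.frobeniusTrace 2 = 0 → W.Δ < 0 →
      ∃ (A : WeierstrassCurve ℚ) (_ : A.IsElliptic) (_ : A.IsGloballyMinimal), GoodSS A 2 ∧ A.frobeniusTrace 2 = 0 ∧
        (∃ e : WeierstrassCurve.geomTorsion W (2 : ℤ) ≃+ WeierstrassCurve.geomTorsion A (2 : ℤ),
          ∀ (σ : Field.absoluteGaloisGroup ℚ) (P : WeierstrassCurve.geomTorsion W (2 : ℤ)), e (σ • P) = σ • e P) ∧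
        ∀ (κ : ZpExtension ℚ 2) (γ : Field.absoluteGaloisGroup ℚ), κ.IsCyclotomic → κ.IsTopGenerator γ →
          ∃ a b : ℕ, a ≤ b ∧
            Nat.card {s : signedSelmerInfty A κ 1 // 2 • s = 0 ∧ ((conjSignedSelmerInfty A κ 1 γ - 1) ^ b) s = 0} <
              2 ^ (b - a) *
                Nat.card {s : signedSelmerInfty A κ 1 // 2 • s = 0 ∧ ((conjSignedSelmerInfty A κ 1 γ - 1) ^ a) s = 0}) :
    ∀ (W : WeierstrassCurve ℚ) [W.IsElliptic] [W.IsGloballyMinimal], ¬ W.HasCM → W.analyticRank = 0 →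
      GoodSS W 2 → W.frobeniusTrace 2 = 0 → W.Δ < 0 →
      ∀ (κ : ZpExtension ℚ 2) (γ : Field.absoluteGaloisGroup ℚ), κ.IsCyclotomic → κ.IsTopGenerator γ →
      ∀ (D : SignedSelmerDualData W κ γ 1) [Module.Finite (IwasawaAlgebra 2) D.X],
        Module.IsTorsion (IwasawaAlgebra 2) D.X ∧ D.mu = 0 :=
  muAlgebraic_iff_signedMuSeedAtTwoPlus.mpr (signedMuSeedAtTwoPlus_of_fixedCertificate hcert)

/-- **THE CRUX Kμ⁺ `SignedMuVanishingAtTwoPlus` BY NAME from {the Selmer-currency certificates, the analytic child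
21437}** (lead g3's `signedMuVanishingAtTwoPlus_of_analytic_of_seed`). Both hypotheses are research / per-class
certificates; BSD is not proved by this. [cite: GreenbergVatsal2000, Prop. (2.8)] [cite: Pollack2003, Prop. 6.18] -/
theorem signedMuVanishingAtTwoPlus_of_fixedCertificate_of_analytic (hAn : SignedMuAnalyticAtTwoPlus)
    (hcert : ∀ (W : WeierstrassCurve ℚ) [W.IsElliptic] [W.IsGloballyMinimal], ¬ W.HasCM → W.analyticRank = 0 →
      GoodSS W 2 → W.frobeniusTrace 2 = 0 → W.Δ < 0 →
      ∃ (A : WeierstrassCurve ℚ) (_ : A.IsElliptic) (_ : A.IsGloballyMinimal), GoodSS A 2 ∧ A.frobeniusTrace 2 = 0 ∧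
        (∃ e : WeierstrassCurve.geomTorsion W (2 : ℤ) ≃+ WeierstrassCurve.geomTorsion A (2 : ℤ),
          ∀ (σ : Field.absoluteGaloisGroup ℚ) (P : WeierstrassCurve.geomTorsion W (2 : ℤ)), e (σ • P) = σ • e P) ∧
        ∀ (κ : ZpExtension ℚ 2) (γ : Field.absoluteGaloisGroup ℚ), κ.IsCyclotomic → κ.IsTopGenerator γ →
          ∃ a b : ℕ, a ≤ b ∧
            Nat.card {s : signedSelmerInfty A κ 1 // 2 • s = 0 ∧ ((conjSignedSelmerInfty A κ 1 γ - 1) ^ b) s = 0} <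
              2 ^ (b - a) *
                Nat.card {s : signedSelmerInfty A κ 1 // 2 • s = 0 ∧ ((conjSignedSelmerInfty A κ 1 γ - 1) ^ a) s = 0}) :
    SignedMuVanishingAtTwoPlus :=
  signedMuVanishingAtTwoPlus_of_analytic_of_seed hAn (signedMuSeedAtTwoPlus_of_fixedCertificate hcert)

end Seed

end Summit.BirchSwinnertonDyer.BirchSwinnertonDyer.Theorems.SignedMuAtTwo.LayerDual

end
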